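import Literature.NumberTheory.Automorphic.IsomorphismGraphLieGens
import Mathlib.LinearAlgebra.RootSystem.Base
import HarnessLib

/-!
# The Lie algebra of the graph subgroup, II: the triangular decomposition of `𝔡_S`
(trunk T-AUTOMORPHIC, G25 AutomorphicL; step 4 of the graph proof of `chevalley_isomorphism_abstract`)

Continuation of `IsomorphismGraphLieGens.lean` (namespace `Literature.NumberTheory.Automorphic`).
For `(G, T)`, `(G', T')` connected reductive over an algebraically closed field of characteristic
`0` with the same root datum `P`, a base `b` of `P` (Mathlib `RootPairing.Base`; simple roots
`α_s`, `s ∈ b.support`) and the graph data `T̃`, `ẽ_s`, `f̃_s`, `h̃_s`, `H = H_{b.support}`,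
`𝔡 = 𝔡_{b.support}` of the previous files, this file proves the **triangular decomposition**

  `𝔡 = Lie(T̃) ⊕ 𝔫⁺ ⊕ 𝔫⁻`,  `𝔫⁺ = ⟨ẽ_s⟩_{Lie}`, `𝔫⁻ = ⟨f̃_s⟩_{Lie}` (`graphLieGen_toSubmodule_eq`),

exactly as in the first (easy) part of Serre's theorem (Humphreys, *Introduction to Lie Algebras*,
18.2, proof of (a)–(c): the relations `[h, e_s] = ⟨α_s, h⟩ e_s`, `[e_s, f_t] = δ_{st} h_s` alone
make `𝔥 + 𝔫⁺ + 𝔫⁻` a subalgebra), and draws the two consequences used by the graph proof of the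
isomorphism theorem (Humphreys 14.2 / Steinberg §10 / Springer 9.6.2):

* **`𝔡 ∩ (𝔤𝔩)_{χ̃_{α_s}} = k ẽ_s` for `s` simple** (`exists_eq_smul_graphE_of_mem_graphLieGen`): the
  weights of `𝔫⁺` are non-zero `ℕ`-combinations of simple roots, those of brackets of length
  `≥ 2` have degree `≥ 2` and so differ from `α_s` by the linear independence of the simple
  roots (`RootPairing.Base.linearIndepOn_root`; the cone combinatorics `coneWt`, `posConeWt`,
  `posConeWt₂`), and the weight spaces of the torus `T̃` are independent
  (`disjoint_weightSpaceGL_graphTorus`, from `iSupIndep_adWeightSpace`);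
* **`𝔡 ∩ (𝔤𝔩)^{T̃} = Lie(T̃)`** (`mem_lieAlgebraGL_graphTorus_of_mem_graphLieGen`).

Ingredients proved on the way: `[Lie T̃, 𝔫^±] ⊆ 𝔫^±` (`lie_mem_nPos_of_mem_lieAlgebraGL_graphTorus`),
`[ẽ_s, 𝔫⁻] ⊆ Lie T̃ + 𝔫⁻` (`lie_graphE_mem_of_mem_nNeg`; the case `[ẽ_s, f̃_t] = 0`, `s ≠ t`, is
`α_s - α_t ∉ R`, `RootPairing.Base.sub_notMem_range_root`, read in `Lie(H)` through
`mem_lieAlgebraGL_graphGroup_weight_eq_zero`), the derivation argument `lie_mem_graphTri`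
(`lieSpan_induction` + `lie_lie`), and the weight bounds `nPos_le_coneSup`, `nPos_le_spanE_sup`.

Everything is proved; no named fact is introduced.

## Mathlib

`RootPairing.Base` (`support`, `linearIndepOn_root`, `sub_notMem_range_root`),
`Fintype.linearIndependent_iff`, `LieSubalgebra.lieSpan` / `lieSpan_induction` / `lieSpan_le`,
`lie_lie`, `iSupIndep.disjoint_biSup`, `Submodule.mem_sup`, `Submodule.mem_span_range_iff_exists_fun`,
`Submodule.iSup_induction`. Nothing here duplicates a Mathlib or Literature declaration (searched
`coneWt`, `posCone`, `graphTri`, `nPos`, `disjoint_weightSpaceGL`).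

## References

* [SpringerLAG1998] T. A. Springer, *Linear Algebraic Groups*, 2nd ed. (1998): 7.1.1, 8.1.1,
  Theorem 9.6.2.
* [Humphreys1972] J. E. Humphreys, *Introduction to Lie Algebras and Representation Theory*,
  GTM 9 (1972), §14.2, §18.1–18.2.
* R. Steinberg, *Lectures on Chevalley groups*, Yale (1968), §10.
-/

noncomputable section

open scoped MatrixGroups IsMulCommutative
open Matrix

namespace Literature.NumberTheory.Automorphic

attribute [local instance 100] LieRing.ofAssociativeRing

variable {k : Type*} [Field k] {n n' : Type*} [Fintype n] [DecidableEq n] [Fintype n']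
  [DecidableEq n']
variable {ι X Y : Type*} [AddCommGroup X] [AddCommGroup Y]

/-! ### Cone combinatorics of a base -/

section Cone

variable {P : RootPairing ι ℤ X Y} (b : P.Base)

/-- The weight `∑_s c_s α_s ∈ X` of a coefficient vector `c : b.support → ℕ`. [folklore] -/
def coneWt (c : ↥b.support → ℕ) : X := ∑ s, (c s : ℤ) • P.root (s : ι)

/-- The degree `∑_s c_s` of a coefficient vector. [folklore] -/
def coneDeg (c : ↥b.support → ℕ) : ℕ := ∑ s, c s

/-- `coneWt` is additive. [folklore] -/
lemma coneWt_add (c c' : ↥b.support → ℕ) : coneWt b (c + c') = coneWt b c + coneWt b c' := by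
  simp only [coneWt, Pi.add_apply, Nat.cast_add, add_smul, Finset.sum_add_distrib]

/-- `coneDeg` is additive. [folklore] -/
lemma coneDeg_add (c c' : ↥b.support → ℕ) : coneDeg b (c + c') = coneDeg b c + coneDeg b c' := by
  simp only [coneDeg, Pi.add_apply, Finset.sum_add_distrib]

open Classical in
/-- The weight of the basis vector `δ_s` is the simple root `α_s`. [folklore] -/
lemma coneWt_single (s : ↥b.support) : coneWt b (Pi.single s 1) = P.root (s : ι) := by
  classical
  rw [coneWt, Finset.sum_eq_single s]
  · simp
  · intro t _ hts; simp [hts]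
  · intro hs; exact absurd (Finset.mem_univ s) hs

open Classical in
/-- The degree of `δ_s` is `1`. [folklore] -/
lemma coneDeg_single (s : ↥b.support) : coneDeg b (Pi.single s 1) = 1 := by
  classical
  rw [coneDeg, Finset.sum_eq_single s]
  · simp
  · intro t _ hts; simp [hts]
  · intro hs; exact absurd (Finset.mem_univ s) hs

/-- The zero vector has degree `0`, and conversely. [folklore] -/
lemma coneDeg_eq_zero_iff (c : ↥b.support → ℕ) : coneDeg b c = 0 ↔ c = 0 := by
  rw [coneDeg, Finset.sum_eq_zero_iff]
  constructor
  · intro h; funext s; exact h s (Finset.mem_univ s)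
  · rintro rfl s _; rfl

/-- **`coneWt` is injective**: the simple roots are linearly independent over `ℤ`
(`RootPairing.Base.linearIndepOn_root`). [folklore] -/
theorem coneWt_injective : Function.Injective (coneWt b) := by
  intro c c' hcc'
  have hli : LinearIndependent ℤ fun s : ↥b.support => P.root (s : ι) :=
    b.linearIndepOn_root.linearIndependent
  rw [Fintype.linearIndependent_iff] at hli
  have h0 : ∑ s : ↥b.support, ((c s : ℤ) - (c' s : ℤ)) • P.root (s : ι) = 0 := by
    simp only [sub_smul, Finset.sum_sub_distrib]
    exact sub_eq_zero.2 hcc'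
  funext s
  have := hli _ h0 s
  exact_mod_cast sub_eq_zero.1 this

/-- The *positive cone*: the weights of the non-zero coefficient vectors (non-trivial
`ℕ`-combinations of simple roots). [folklore] -/
def posConeWt : Set X := {x | ∃ c : ↥b.support → ℕ, 1 ≤ coneDeg b c ∧ coneWt b c = x}

/-- The weights of coefficient vectors of degree `≥ 2` (combinations of at least two simple roots,
with multiplicity). [folklore] -/
def posConeWt₂ : Set X := {x | ∃ c : ↥b.support → ℕ, 2 ≤ coneDeg b c ∧ coneWt b c = x}

/-- Simple roots lie in the positive cone. [folklore] -/
lemma root_mem_posConeWt (s : ↥b.support) : P.root (s : ι) ∈ posConeWt b := by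
  classical
  exact ⟨Pi.single s 1, by rw [coneDeg_single], coneWt_single b s⟩

/-- `posConeWt₂ ⊆ posConeWt`. [folklore] -/
lemma posConeWt₂_subset : posConeWt₂ b ⊆ posConeWt b := by
  rintro x ⟨c, hc, rfl⟩; exact ⟨c, le_trans (by norm_num) hc, rfl⟩

/-- The sum of two elements of the positive cone has degree `≥ 2`. [folklore] -/
lemma add_mem_posConeWt₂ {x y : X} (hx : x ∈ posConeWt b) (hy : y ∈ posConeWt b) : x + y ∈ posConeWt₂ b := by
  obtain ⟨c, hc, rfl⟩ := hx
  obtain ⟨c', hc', rfl⟩ := hy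
  exact ⟨c + c', by rw [coneDeg_add]; omega, coneWt_add b c c'⟩

/-- The positive cone is closed under addition. [folklore] -/
lemma add_mem_posConeWt {x y : X} (hx : x ∈ posConeWt b) (hy : y ∈ posConeWt b) : x + y ∈ posConeWt b :=
  posConeWt₂_subset b (add_mem_posConeWt₂ b hx hy)

/-- `0` is not in the positive cone. [folklore] -/
lemma zero_notMem_posConeWt : (0 : X) ∉ posConeWt b := by
  rintro ⟨c, hc, h0⟩
  have : c = 0 := coneWt_injective b (by rw [h0]; simp [coneWt])
  rw [this, (coneDeg_eq_zero_iff b 0).2 rfl] at hc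
  exact absurd hc (by norm_num)

/-- Elements of the positive cone are non-zero. [folklore] -/
lemma ne_zero_of_mem_posConeWt {x : X} (hx : x ∈ posConeWt b) : x ≠ 0 := by
  rintro rfl; exact zero_notMem_posConeWt b hx

/-- **A simple root is not a combination of two or more simple roots** (linear independence).
[folklore] -/
lemma root_notMem_posConeWt₂ (s : ↥b.support) : P.root (s : ι) ∉ posConeWt₂ b := by
  classical
  rintro ⟨c, hc, h⟩
  rw [← coneWt_single b s] at h
  have := coneWt_injective b h
  rw [this, coneDeg_single] at hc
  exact absurd hc (by norm_num)

/-- The positive cone meets its negative trivially. [folklore] -/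
lemma neg_notMem_posConeWt {x : X} (hx : x ∈ posConeWt b) : -x ∉ posConeWt b := by
  rintro ⟨c', hc', h'⟩
  obtain ⟨c, hc, rfl⟩ := hx
  have h0 : coneWt b (c + c') = coneWt b 0 := by
    rw [coneWt_add, h', add_neg_cancel]; simp [coneWt]
  have := coneWt_injective b h0
  have hdeg := congrArg (coneDeg b) this
  rw [coneDeg_add, (coneDeg_eq_zero_iff b 0).2 rfl] at hdeg
  omega

/-- Distinct elements of the support have distinct roots. [folklore] -/
lemma root_ne_root_of_ne {s t : ↥b.support} (hst : s ≠ t) : P.root (s : ι) ≠ P.root (t : ι) := by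
  classical
  intro h
  apply hst
  rw [← coneWt_single b s, ← coneWt_single b t] at h
  have := coneWt_injective b h
  by_contra hne
  have := congrFun this t
  simp [Ne.symm hne] at this

end Cone

variable {G T : Subgroup (GL n k)} {G' T' : Subgroup (GL n' k)}
variable [IsMulCommutative ↥T] [IsMulCommutative ↥T']
variable {P : RootPairing ι ℤ X Y}
variable {eX : Additive ↥(characterLattice T) ≃+ X} {eY : Additive ↥(cocharacterLattice T) ≃+ Y}
variable {eX' : Additive ↥(characterLattice T') ≃+ X} {eY' : Additive ↥(cocharacterLattice T') ≃+ Y}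

/-! ### Independence of the weight spaces of the graph torus -/

section WeightIndep

variable [IsAlgClosed k] (eX eX') (hT : IsTorusSubgroup T) (hT' : IsTorusSubgroup T')

/-- Shorthand: the weight space `(𝔤𝔩_{n+n'})_{χ̃_x}` of the graph torus. [folklore] -/
abbrev grW (x : X) : Submodule k (Matrix (n ⊕ n') (n ⊕ n') k) :=
  weightSpaceGL (graphTorus eX eX' hT hT') (graphChar eX eX' hT hT' x)

/-- **The weight spaces `(𝔤𝔩)_{χ̃_x}`, `x ∈ X`, are independent**: `(𝔤𝔩)_{χ̃_{x₀}}` meets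
`⨆_{x ≠ x₀} (𝔤𝔩)_{χ̃_x}` trivially (`T̃` is a commutative group of semisimple elements,
`iSupIndep_adWeightSpace`, and `x ↦ χ̃_x` is injective). [cite: SpringerLAG1998, 7.1.1] -/
theorem disjoint_weightSpaceGL_graphTorus (x₀ : X) :
    Disjoint (grW eX eX' hT hT' x₀) (⨆ (x : X) (_ : x ≠ x₀), grW eX eX' hT hT' x) := by
  haveI : IsMulCommutative ↥(graphTorus eX eX' hT hT') := isMulCommutative_graphTorus eX eX' hT hT'
  let w : X → (↥(graphTorus eX eX' hT hT') → k) := fun x t => ((graphChar eX eX' hT hT' x t : kˣ) : k)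
  have hw : Function.Injective w := by
    intro x y hxy
    apply graphChar_injective eX eX' hT hT'
    ext t
    exact congrFun hxy t
  have hWe : ∀ x, grW eX eX' hT hT' x = adWeightSpace (graphTorus eX eX' hT hT') (w x) := fun x =>
    weightSpaceGL_eq_adWeightSpace _
  have hind := iSupIndep_adWeightSpace (graphTorus eX eX' hT hT')
    (isTorusSubgroup_graphTorus eX eX' hT hT').2.2
  have hd := hind.disjoint_biSup (x := w x₀) (y := {f | f ≠ w x₀}) (by simp)
  rw [hWe]
  refine hd.mono_right ?_
  refine iSup₂_le fun x hx => ?_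
  rw [hWe]
  exact le_biSup (fun f => adWeightSpace (graphTorus eX eX' hT hT') f) (hw.ne hx)

/-- **Components are unique**: if `M, N` have weight `x₀` and `M - N ∈ ⨆_{x ≠ x₀} (𝔤𝔩)_{χ̃_x}` then
`M = N`. [folklore] -/
theorem eq_of_sub_mem_biSup_weightSpaceGL {x₀ : X} {M N : Matrix (n ⊕ n') (n ⊕ n') k}
    (hM : M ∈ grW eX eX' hT hT' x₀) (hN : N ∈ grW eX eX' hT hT' x₀)
    (hMN : M - N ∈ ⨆ (x : X) (_ : x ≠ x₀), grW eX eX' hT hT' x) : M = N := by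
  have hd := disjoint_weightSpaceGL_graphTorus eX eX' hT hT' x₀
  rw [Submodule.disjoint_def] at hd
  exact sub_eq_zero.1 (hd _ (Submodule.sub_mem _ hM hN) hMN)

/-- Brackets of weight vectors: `[(𝔤𝔩)_{χ̃_x}, (𝔤𝔩)_{χ̃_y}] ⊆ (𝔤𝔩)_{χ̃_{x+y}}`. [folklore] -/
theorem lie_mem_grW {x y : X} {A B : Matrix (n ⊕ n') (n ⊕ n') k} (hA : A ∈ grW eX eX' hT hT' x)
    (hB : B ∈ grW eX eX' hT hT' y) : A * B - B * A ∈ grW eX eX' hT hT' (x + y) := by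
  have h := lie_mem_weightSpaceGL hA hB
  rwa [← graphChar_add] at h

/-- `Lie(T̃) ⊆ (𝔤𝔩)_{χ̃_0}` (a commutative `T̃` acts trivially on its Lie algebra). [folklore] -/
theorem lieAlgebraGL_graphTorus_le_grW_zero : lieAlgebraGL (graphTorus eX eX' hT hT') ≤ grW eX eX' hT hT' 0 := by
  haveI : IsMulCommutative ↥(graphTorus eX eX' hT hT') := isMulCommutative_graphTorus eX eX' hT hT'
  intro A hA
  change A ∈ weightSpaceGL _ (graphChar eX eX' hT hT' 0)
  rw [graphChar_zero]
  exact lieAlgebraGL_le_weightSpaceGL_one hA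

end WeightIndep

/-! ### The nilpotent parts `𝔫⁺ = ⟨ẽ_s⟩`, `𝔫⁻ = ⟨f̃_s⟩` and their weights -/

section Nilpotent

variable [IsAlgClosed k] (h : IsRootDatumOf G T P eX eY) (h' : IsRootDatumOf G' T' P eX' eY')
  (hT : IsTorusSubgroup T) (hT' : IsTorusSubgroup T') (b : P.Base)

/-- `𝔫⁺`: the Lie subalgebra generated by the `ẽ_s`, `s` simple. [folklore] -/
def nPos : LieSubalgebra k (Matrix (n ⊕ n') (n ⊕ n') k) :=
  LieSubalgebra.lieSpan k _ (Set.range fun s : ↥b.support => graphE h h' (s : ι))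

/-- `𝔫⁻`: the Lie subalgebra generated by the `f̃_s`, `s` simple. [folklore] -/
def nNeg : LieSubalgebra k (Matrix (n ⊕ n') (n ⊕ n') k) :=
  LieSubalgebra.lieSpan k _ (Set.range fun s : ↥b.support => graphF h h' (s : ι))

variable (eX eX') in
/-- The sum of the weight spaces of the positive cone. [folklore] -/
def coneSupPos : Submodule k (Matrix (n ⊕ n') (n ⊕ n') k) := ⨆ x : ↥(posConeWt b), grW eX eX' hT hT' (x : X)

variable (eX eX') in
/-- The sum of the weight spaces of the negatives of the positive cone. [folklore] -/
def coneSupNeg : Submodule k (Matrix (n ⊕ n') (n ⊕ n') k) := ⨆ x : ↥(posConeWt b), grW eX eX' hT hT' (-(x : X))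

variable (eX eX') in
/-- The sum of the weight spaces of degree `≥ 2`. [folklore] -/
def coneSupPos₂ : Submodule k (Matrix (n ⊕ n') (n ⊕ n') k) := ⨆ x : ↥(posConeWt₂ b), grW eX eX' hT hT' (x : X)

variable (eX eX') in
/-- The sum of the weight spaces of degree `≥ 2`, negative side. [folklore] -/
def coneSupNeg₂ : Submodule k (Matrix (n ⊕ n') (n ⊕ n') k) := ⨆ x : ↥(posConeWt₂ b), grW eX eX' hT hT' (-(x : X))

/-- The span of the `ẽ_s`. [folklore] -/
def spanE : Submodule k (Matrix (n ⊕ n') (n ⊕ n') k) := Submodule.span k (Set.range fun s : ↥b.support => graphE h h' (s : ι))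

/-- The span of the `f̃_s`. [folklore] -/
def spanF : Submodule k (Matrix (n ⊕ n') (n ⊕ n') k) := Submodule.span k (Set.range fun s : ↥b.support => graphF h h' (s : ι))

variable {b}

/-- A sum of weight spaces over a set of weights, closed under addition of weights, is closed under
the bracket. [folklore] -/
theorem lie_mem_iSup_grW_of_add_mem {C : Set X} (hC : ∀ x ∈ C, ∀ y ∈ C, x + y ∈ C)
    {A B : Matrix (n ⊕ n') (n ⊕ n') k} (hA : A ∈ ⨆ x : ↥C, grW eX eX' hT hT' (x : X))
    (hB : B ∈ ⨆ x : ↥C, grW eX eX' hT hT' (x : X)) : A * B - B * A ∈ ⨆ x : ↥C, grW eX eX' hT hT' (x : X) := by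
  revert B
  refine Submodule.iSup_induction _ (motive := fun A => ∀ {B}, B ∈ ⨆ x : ↥C, grW eX eX' hT hT' (x : X) →
    A * B - B * A ∈ ⨆ x : ↥C, grW eX eX' hT hT' (x : X)) hA ?_ ?_ ?_
  · intro x A hA B hB
    refine Submodule.iSup_induction _ (motive := fun B => A * B - B * A ∈ ⨆ x : ↥C, grW eX eX' hT hT' (x : X)) hB
      ?_ ?_ ?_
    · intro y B hB
      exact Submodule.mem_iSup_of_mem ⟨x + y, hC _ x.2 _ y.2⟩ (lie_mem_grW eX eX' hT hT' hA hB)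
    · simp
    · intro B B' hB hB'
      have : A * (B + B') - (B + B') * A = (A * B - B * A) + (A * B' - B' * A) := by
        rw [Matrix.mul_add, Matrix.add_mul]; abel
      rw [this]; exact add_mem hB hB'
  · intro B _; simp
  · intro A A' hA hA' B hB
    have : (A + A') * B - B * (A + A') = (A * B - B * A) + (A' * B - B * A') := by
      rw [Matrix.add_mul, Matrix.mul_add]; abel
    rw [this]; exact add_mem (hA hB) (hA' hB)

/-- A sum of weight spaces over the negatives of a set closed under addition is closed under the
bracket. [folklore] -/
theorem lie_mem_iSup_grW_neg_of_add_mem {C : Set X} (hC : ∀ x ∈ C, ∀ y ∈ C, x + y ∈ C)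
    {A B : Matrix (n ⊕ n') (n ⊕ n') k} (hA : A ∈ ⨆ x : ↥C, grW eX eX' hT hT' (-(x : X)))
    (hB : B ∈ ⨆ x : ↥C, grW eX eX' hT hT' (-(x : X))) : A * B - B * A ∈ ⨆ x : ↥C, grW eX eX' hT hT' (-(x : X)) := by
  have e : (⨆ x : ↥C, grW eX eX' hT hT' (-(x : X))) = ⨆ x : ↥(-C), grW eX eX' hT hT' (x : X) := by
    apply le_antisymm
    · exact iSup_le fun x => le_iSup (fun y : ↥(-C) => grW eX eX' hT hT' (y : X)) ⟨-(x : X), by simp⟩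
    · refine iSup_le fun y => ?_
      have hy : -(y : X) ∈ C := y.2
      have : grW eX eX' hT hT' (y : X) = grW eX eX' hT hT' (-((⟨-(y : X), hy⟩ : ↥C) : X)) := by simp
      rw [this]
      exact le_iSup (fun x : ↥C => grW eX eX' hT hT' (-(x : X))) ⟨-(y : X), hy⟩
  rw [e] at hA hB ⊢
  refine lie_mem_iSup_grW_of_add_mem hT hT' (C := -C) (fun x hx y hy => ?_) hA hB
  have : -(x + y) = -x + -y := neg_add x y
  show -(x + y) ∈ C
  rw [this]; exact hC _ hx _ hy

variable [Infinite k]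

/-- **The weights of `𝔫⁺` lie in the positive cone**: `𝔫⁺ ⊆ ⨆_{x ∈ C⁺} (𝔤𝔩)_{χ̃_x}`. [folklore] -/
theorem nPos_le_coneSup : (nPos h h' b).toSubmodule ≤ coneSupPos eX eX' hT hT' b := by
  intro M hM
  change M ∈ nPos h h' b at hM
  induction hM using LieSubalgebra.lieSpan_induction with
  | mem x hx =>
    obtain ⟨s, rfl⟩ := hx
    exact Submodule.mem_iSup_of_mem ⟨_, root_mem_posConeWt b s⟩ (graphE_mem_weightSpaceGL h h' hT hT' s)
  | zero => exact Submodule.zero_mem _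
  | add x y _ _ hx hy => exact add_mem hx hy
  | smul a x _ hx => exact Submodule.smul_mem _ a hx
  | lie x y _ _ hx hy =>
    rw [Ring.lie_def]
    exact lie_mem_iSup_grW_of_add_mem hT hT' (fun _ hx _ hy => add_mem_posConeWt b hx hy) hx hy

/-- **The weights of `𝔫⁻` lie in the negative cone.** [folklore] -/
theorem nNeg_le_coneSup : (nNeg h h' b).toSubmodule ≤ coneSupNeg eX eX' hT hT' b := by
  intro M hM
  change M ∈ nNeg h h' b at hM
  induction hM using LieSubalgebra.lieSpan_induction with
  | mem x hx =>
    obtain ⟨s, rfl⟩ := hx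
    exact Submodule.mem_iSup_of_mem ⟨_, root_mem_posConeWt b s⟩ (graphF_mem_weightSpaceGL h h' hT hT' s)
  | zero => exact Submodule.zero_mem _
  | add x y _ _ hx hy => exact add_mem hx hy
  | smul a x _ hx => exact Submodule.smul_mem _ a hx
  | lie x y _ _ hx hy =>
    rw [Ring.lie_def]
    exact lie_mem_iSup_grW_neg_of_add_mem hT hT' (fun _ hx _ hy => add_mem_posConeWt b hx hy) hx hy

/-- Elements of the span of the `ẽ_s` bracket into the degree-`≥ 2` part. [folklore] -/
lemma lie_mem_coneSupPos₂_of_mem_spanE {A : Matrix (n ⊕ n') (n ⊕ n') k} (hA : A ∈ spanE h h' b)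
    (B : Matrix (n ⊕ n') (n ⊕ n') k) (hB : B ∈ spanE h h' b ⊔ coneSupPos₂ eX eX' hT hT' b) :
    A * B - B * A ∈ coneSupPos₂ eX eX' hT hT' b := by
  -- both `spanE` and `coneSupPos₂` lie in `coneSupPos`
  have hle : spanE h h' b ⊔ coneSupPos₂ eX eX' hT hT' b ≤ coneSupPos eX eX' hT hT' b := by
    refine sup_le ?_ ?_
    · rw [spanE, Submodule.span_le]
      rintro _ ⟨s, rfl⟩
      exact Submodule.mem_iSup_of_mem ⟨_, root_mem_posConeWt b s⟩ (graphE_mem_weightSpaceGL h h' hT hT' s)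
    · exact iSup_le fun x => le_iSup (fun y : ↥(posConeWt b) => grW eX eX' hT hT' (y : X)) ⟨x, posConeWt₂_subset b x.2⟩
  -- induct on `A ∈ spanE` (a span) and on `B ∈ coneSupPos`
  revert B
  refine Submodule.span_induction ?_ ?_ ?_ ?_ hA
  · rintro _ ⟨s, rfl⟩ B hB
    refine Submodule.iSup_induction _ (motive := fun B => graphE h h' s * B - B * graphE h h' s ∈
      coneSupPos₂ eX eX' hT hT' b) (hle hB) ?_ ?_ ?_
    · intro y B hB
      exact Submodule.mem_iSup_of_mem ⟨_, add_mem_posConeWt₂ b (root_mem_posConeWt b s) y.2⟩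
        (lie_mem_grW eX eX' hT hT' (graphE_mem_weightSpaceGL h h' hT hT' s) hB)
    · simp
    · intro B B' hB hB'
      have : graphE h h' s * (B + B') - (B + B') * graphE h h' s =
          (graphE h h' s * B - B * graphE h h' s) + (graphE h h' s * B' - B' * graphE h h' s) := by
        rw [Matrix.mul_add, Matrix.add_mul]; abel
      rw [this]; exact add_mem hB hB'
  · intro B _; simp
  · intro A A' _ _ hA hA' B hB
    have : (A + A') * B - B * (A + A') = (A * B - B * A) + (A' * B - B * A') := by
      rw [Matrix.add_mul, Matrix.mul_add]; abel
    rw [this]; exact add_mem (hA _ hB) (hA' _ hB)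
  · intro a A _ hA B hB
    have : (a • A) * B - B * (a • A) = a • (A * B - B * A) := by
      rw [Matrix.smul_mul, Matrix.mul_smul, smul_sub]
    rw [this]; exact Submodule.smul_mem _ a (hA _ hB)

/-- **`𝔫⁺ ⊆ span{ẽ_s} ⊕ ⨆_{deg ≥ 2} (𝔤𝔩)_{χ̃_x}`**: the right-hand side is a subalgebra containing
the `ẽ_s` (brackets raise the degree). [folklore] -/
theorem nPos_le_spanE_sup : (nPos h h' b).toSubmodule ≤ spanE h h' b ⊔ coneSupPos₂ eX eX' hT hT' b := by
  intro M hM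
  change M ∈ nPos h h' b at hM
  induction hM using LieSubalgebra.lieSpan_induction with
  | mem x hx =>
    exact Submodule.mem_sup_left (Submodule.subset_span hx)
  | zero => exact Submodule.zero_mem _
  | add x y _ _ hx hy => exact add_mem hx hy
  | smul a x _ hx => exact Submodule.smul_mem _ a hx
  | lie x y _ _ hx hy =>
    rw [Ring.lie_def]
    refine Submodule.mem_sup_right ?_
    obtain ⟨e₁, he₁, r₁, hr₁, rfl⟩ := Submodule.mem_sup.1 hx
    have h2 : ∀ x ∈ posConeWt₂ b, ∀ y ∈ posConeWt₂ b, x + y ∈ posConeWt₂ b := fun x hx y hy =>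
      add_mem_posConeWt₂ b (posConeWt₂_subset b hx) (posConeWt₂_subset b hy)
    -- `[e₁, y] ∈ coneSupPos₂`
    have t1 := lie_mem_coneSupPos₂_of_mem_spanE h h' hT hT' he₁ _ hy
    -- `[r₁, y]`: decompose `y`
    obtain ⟨e₂, he₂, r₂, hr₂, rfl⟩ := Submodule.mem_sup.1 hy
    have t2 : r₁ * e₂ - e₂ * r₁ ∈ coneSupPos₂ eX eX' hT hT' b := by
      have := lie_mem_coneSupPos₂_of_mem_spanE h h' hT hT' he₂ _ (Submodule.mem_sup_right hr₁ :
        r₁ ∈ spanE h h' b ⊔ coneSupPos₂ eX eX' hT hT' b)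
      have e : r₁ * e₂ - e₂ * r₁ = -(e₂ * r₁ - r₁ * e₂) := by abel
      rw [e]; exact Submodule.neg_mem _ this
    have t3 : r₁ * r₂ - r₂ * r₁ ∈ coneSupPos₂ eX eX' hT hT' b := lie_mem_iSup_grW_of_add_mem hT hT' h2 hr₁ hr₂
    have e : (e₁ + r₁) * (e₂ + r₂) - (e₂ + r₂) * (e₁ + r₁) =
        (e₁ * (e₂ + r₂) - (e₂ + r₂) * e₁) + ((r₁ * e₂ - e₂ * r₁) + (r₁ * r₂ - r₂ * r₁)) := by
      simp only [Matrix.add_mul, Matrix.mul_add]; abel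
    rw [e]
    exact add_mem t1 (add_mem t2 t3)

/-- Symmetrically for `𝔫⁻`: brackets from the span of the `f̃_s`. [folklore] -/
lemma lie_mem_coneSupNeg₂_of_mem_spanF {A : Matrix (n ⊕ n') (n ⊕ n') k} (hA : A ∈ spanF h h' b)
    (B : Matrix (n ⊕ n') (n ⊕ n') k) (hB : B ∈ spanF h h' b ⊔ coneSupNeg₂ eX eX' hT hT' b) :
    A * B - B * A ∈ coneSupNeg₂ eX eX' hT hT' b := by
  have hle : spanF h h' b ⊔ coneSupNeg₂ eX eX' hT hT' b ≤ coneSupNeg eX eX' hT hT' b := by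
    refine sup_le ?_ ?_
    · rw [spanF, Submodule.span_le]
      rintro _ ⟨s, rfl⟩
      exact Submodule.mem_iSup_of_mem ⟨_, root_mem_posConeWt b s⟩ (graphF_mem_weightSpaceGL h h' hT hT' s)
    · exact iSup_le fun x => le_iSup (fun y : ↥(posConeWt b) => grW eX eX' hT hT' (-(y : X))) ⟨x, posConeWt₂_subset b x.2⟩
  revert B
  refine Submodule.span_induction ?_ ?_ ?_ ?_ hA
  · rintro _ ⟨s, rfl⟩ B hB
    refine Submodule.iSup_induction _ (motive := fun B => graphF h h' s * B - B * graphF h h' s ∈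
      coneSupNeg₂ eX eX' hT hT' b) (hle hB) ?_ ?_ ?_
    · intro y B hB
      have hmem := lie_mem_grW eX eX' hT hT' (graphF_mem_weightSpaceGL h h' hT hT' s) hB
      rw [← neg_add] at hmem
      exact Submodule.mem_iSup_of_mem ⟨_, add_mem_posConeWt₂ b (root_mem_posConeWt b s) y.2⟩ hmem
    · simp
    · intro B B' hB hB'
      have : graphF h h' s * (B + B') - (B + B') * graphF h h' s =
          (graphF h h' s * B - B * graphF h h' s) + (graphF h h' s * B' - B' * graphF h h' s) := by
        rw [Matrix.mul_add, Matrix.add_mul]; abel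
      rw [this]; exact add_mem hB hB'
  · intro B _; simp
  · intro A A' _ _ hA hA' B hB
    have : (A + A') * B - B * (A + A') = (A * B - B * A) + (A' * B - B * A') := by
      rw [Matrix.add_mul, Matrix.mul_add]; abel
    rw [this]; exact add_mem (hA _ hB) (hA' _ hB)
  · intro a A _ hA B hB
    have : (a • A) * B - B * (a • A) = a • (A * B - B * A) := by
      rw [Matrix.smul_mul, Matrix.mul_smul, smul_sub]
    rw [this]; exact Submodule.smul_mem _ a (hA _ hB)

/-- **`𝔫⁻ ⊆ span{f̃_s} ⊕ ⨆_{deg ≥ 2} (𝔤𝔩)_{χ̃_{-x}}`.** [folklore] -/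
theorem nNeg_le_spanF_sup : (nNeg h h' b).toSubmodule ≤ spanF h h' b ⊔ coneSupNeg₂ eX eX' hT hT' b := by
  intro M hM
  change M ∈ nNeg h h' b at hM
  induction hM using LieSubalgebra.lieSpan_induction with
  | mem x hx =>
    exact Submodule.mem_sup_left (Submodule.subset_span hx)
  | zero => exact Submodule.zero_mem _
  | add x y _ _ hx hy => exact add_mem hx hy
  | smul a x _ hx => exact Submodule.smul_mem _ a hx
  | lie x y _ _ hx hy =>
    rw [Ring.lie_def]
    refine Submodule.mem_sup_right ?_
    obtain ⟨e₁, he₁, r₁, hr₁, rfl⟩ := Submodule.mem_sup.1 hx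
    have h2 : ∀ x ∈ posConeWt₂ b, ∀ y ∈ posConeWt₂ b, x + y ∈ posConeWt₂ b := fun x hx y hy =>
      add_mem_posConeWt₂ b (posConeWt₂_subset b hx) (posConeWt₂_subset b hy)
    have t1 := lie_mem_coneSupNeg₂_of_mem_spanF h h' hT hT' he₁ _ hy
    obtain ⟨e₂, he₂, r₂, hr₂, rfl⟩ := Submodule.mem_sup.1 hy
    have t2 : r₁ * e₂ - e₂ * r₁ ∈ coneSupNeg₂ eX eX' hT hT' b := by
      have := lie_mem_coneSupNeg₂_of_mem_spanF h h' hT hT' he₂ _ (Submodule.mem_sup_right hr₁ :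
        r₁ ∈ spanF h h' b ⊔ coneSupNeg₂ eX eX' hT hT' b)
      have e : r₁ * e₂ - e₂ * r₁ = -(e₂ * r₁ - r₁ * e₂) := by abel
      rw [e]; exact Submodule.neg_mem _ this
    have t3 : r₁ * r₂ - r₂ * r₁ ∈ coneSupNeg₂ eX eX' hT hT' b :=
      lie_mem_iSup_grW_neg_of_add_mem hT hT' h2 hr₁ hr₂
    have e : (e₁ + r₁) * (e₂ + r₂) - (e₂ + r₂) * (e₁ + r₁) =
        (e₁ * (e₂ + r₂) - (e₂ + r₂) * e₁) + ((r₁ * e₂ - e₂ * r₁) + (r₁ * r₂ - r₂ * r₁)) := by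
      simp only [Matrix.add_mul, Matrix.mul_add]; abel
    rw [e]
    exact add_mem t1 (add_mem t2 t3)

/-! #### Comparison with the complement of a single weight -/

omit [Infinite k] in
/-- The positive-cone sum avoids weight `0`. [folklore] -/
lemma coneSupPos_le_biSup_ne_zero : coneSupPos eX eX' hT hT' b ≤ ⨆ (x : X) (_ : x ≠ 0), grW eX eX' hT hT' x :=
  iSup_le fun x => le_biSup (fun x => grW eX eX' hT hT' x) (ne_zero_of_mem_posConeWt b x.2)

omit [Infinite k] in
/-- The negative-cone sum avoids weight `0`. [folklore] -/
lemma coneSupNeg_le_biSup_ne_zero : coneSupNeg eX eX' hT hT' b ≤ ⨆ (x : X) (_ : x ≠ 0), grW eX eX' hT hT' x :=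
  iSup_le fun x => le_biSup (fun x => grW eX eX' hT hT' x) (neg_ne_zero.2 (ne_zero_of_mem_posConeWt b x.2))

omit [Infinite k] in
/-- The negative-cone sum avoids the simple root `α_s`. [folklore] -/
lemma coneSupNeg_le_biSup_ne_root (s : ↥b.support) :
    coneSupNeg eX eX' hT hT' b ≤ ⨆ (x : X) (_ : x ≠ P.root (s : ι)), grW eX eX' hT hT' x :=
  iSup_le fun x => le_biSup (fun x => grW eX eX' hT hT' x) (by
    intro hx
    have h1 := root_mem_posConeWt b s
    rw [← hx] at h1
    exact neg_notMem_posConeWt b x.2 h1)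

omit [Infinite k] in
/-- The degree-`≥ 2` sum avoids the simple root `α_s`. [folklore] -/
lemma coneSupPos₂_le_biSup_ne_root (s : ↥b.support) :
    coneSupPos₂ eX eX' hT hT' b ≤ ⨆ (x : X) (_ : x ≠ P.root (s : ι)), grW eX eX' hT hT' x :=
  iSup_le fun x => le_biSup (fun x => grW eX eX' hT hT' x) (by
    intro hx
    have h2 := x.2
    rw [hx] at h2
    exact root_notMem_posConeWt₂ b s h2)

omit [Infinite k] in
/-- `Lie(T̃)` avoids every non-zero weight. [folklore] -/
lemma lieAlgebraGL_graphTorus_le_biSup_ne {x₀ : X} (hx₀ : x₀ ≠ 0) :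
    lieAlgebraGL (graphTorus eX eX' hT hT') ≤ ⨆ (x : X) (_ : x ≠ x₀), grW eX eX' hT hT' x :=
  (lieAlgebraGL_graphTorus_le_grW_zero eX eX' hT hT').trans (le_biSup (fun x => grW eX eX' hT hT' x) hx₀.symm)

/-- The part of `span{ẽ_t}` away from `t = s` avoids `α_s`: an element `∑_t a_t ẽ_t` minus its
`s`-term lies in `⨆_{x ≠ α_s}`. [folklore] -/
lemma sum_sub_single_mem_biSup_ne_root (s : ↥b.support) (a : ↥b.support → k) :
    (∑ t, a t • graphE h h' (t : ι)) - a s • graphE h h' (s : ι) ∈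
      ⨆ (x : X) (_ : x ≠ P.root (s : ι)), grW eX eX' hT hT' x := by
  classical
  rw [← Finset.sum_erase_add _ _ (Finset.mem_univ s), add_sub_cancel_right]
  refine Submodule.sum_mem _ fun t ht => ?_
  have hts : t ≠ s := Finset.ne_of_mem_erase ht
  refine Submodule.smul_mem _ _ ?_
  have hle := le_biSup (fun x => grW eX eX' hT hT' x)
    (show P.root (t : ι) ∈ {x | x ≠ P.root (s : ι)} from root_ne_root_of_ne b hts)
  exact hle (graphE_mem_weightSpaceGL h h' hT hT' t)

omit [Infinite k] in
/-- The positive-cone sum avoids `-α_s`. [folklore] -/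
lemma coneSupPos_le_biSup_ne_neg_root (s : ↥b.support) :
    coneSupPos eX eX' hT hT' b ≤ ⨆ (x : X) (_ : x ≠ -P.root (s : ι)), grW eX eX' hT hT' x :=
  iSup_le fun x => le_biSup (fun x => grW eX eX' hT hT' x) (by
    intro hx
    have h1 : -P.root (s : ι) ∈ posConeWt b := by rw [← hx]; exact x.2
    exact neg_notMem_posConeWt b (root_mem_posConeWt b s) h1)

omit [Infinite k] in
/-- The negative degree-`≥ 2` sum avoids `-α_s`. [folklore] -/
lemma coneSupNeg₂_le_biSup_ne_neg_root (s : ↥b.support) :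
    coneSupNeg₂ eX eX' hT hT' b ≤ ⨆ (x : X) (_ : x ≠ -P.root (s : ι)), grW eX eX' hT hT' x :=
  iSup_le fun x => le_biSup (fun x => grW eX eX' hT hT' x) (by
    intro hx
    have h2 := x.2
    rw [neg_inj.1 hx] at h2
    exact root_notMem_posConeWt₂ b s h2)

/-- The part of `span{f̃_t}` away from `t = s` avoids `-α_s`. [folklore] -/
lemma sum_sub_single_mem_biSup_ne_neg_root (s : ↥b.support) (a : ↥b.support → k) :
    (∑ t, a t • graphF h h' (t : ι)) - a s • graphF h h' (s : ι) ∈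
      ⨆ (x : X) (_ : x ≠ -P.root (s : ι)), grW eX eX' hT hT' x := by
  classical
  rw [← Finset.sum_erase_add _ _ (Finset.mem_univ s), add_sub_cancel_right]
  refine Submodule.sum_mem _ fun t ht => ?_
  have hts : t ≠ s := Finset.ne_of_mem_erase ht
  refine Submodule.smul_mem _ _ ?_
  have hle := le_biSup (fun x => grW eX eX' hT hT' x)
    (show -P.root (t : ι) ∈ {x | x ≠ -P.root (s : ι)} from neg_injective.ne (root_ne_root_of_ne b hts))
  exact hle (graphF_mem_weightSpaceGL h h' hT hT' t)

end Nilpotent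

/-! ### The triangular decomposition `𝔡 = Lie(T̃) + 𝔫⁺ + 𝔫⁻` -/

section Triangular

variable [IsAlgClosed k] [CharZero k] (h : IsRootDatumOf G T P eX eY) (h' : IsRootDatumOf G' T' P eX' eY')
  (b : P.Base) (hG : IsConnectedReductive G) (hTm : IsMaximalTorusIn T G)
  (hG' : IsConnectedReductive G') (hTm' : IsMaximalTorusIn T' G')

/-- The candidate subspace `V = Lie(T̃) + 𝔫⁺ + 𝔫⁻`. [folklore] -/
def graphTri (hT : IsTorusSubgroup T) (hT' : IsTorusSubgroup T') : Submodule k (Matrix (n ⊕ n') (n ⊕ n') k) :=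
  lieAlgebraGL (graphTorus eX eX' hT hT') ⊔ (nPos h h' b).toSubmodule ⊔ (nNeg h h' b).toSubmodule

omit [CharZero k] in
/-- **`[Lie T̃, 𝔫⁺] ⊆ 𝔫⁺`**: `ad A` is a derivation and scales each generator `ẽ_s`
(`[A, ẽ_s] = dχ̃_{α_s}(A) ẽ_s`). [folklore] -/
theorem lie_mem_nPos_of_mem_lieAlgebraGL_graphTorus (hT : IsTorusSubgroup T) (hT' : IsTorusSubgroup T')
    {A : Matrix (n ⊕ n') (n ⊕ n') k} (hA : A ∈ lieAlgebraGL (graphTorus eX eX' hT hT'))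
    {M : Matrix (n ⊕ n') (n ⊕ n') k} (hM : M ∈ nPos h h' b) : A * M - M * A ∈ nPos h h' b := by
  induction hM using LieSubalgebra.lieSpan_induction with
  | mem x hx =>
    obtain ⟨s, rfl⟩ := hx
    obtain ⟨p, hp⟩ := isAlgebraicChar_graphChar eX eX' hT hT' (P.root (s : ι))
    rw [lie_eq_tangentDeriv_smul_of_mem_weightSpaceGL hp (graphE_mem_weightSpaceGL h h' hT hT' s) hA]
    exact (nPos h h' b).smul_mem _ (LieSubalgebra.subset_lieSpan ⟨s, rfl⟩)
  | zero => simp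
  | add x y _ _ hx hy =>
    have : A * (x + y) - (x + y) * A = (A * x - x * A) + (A * y - y * A) := by
      rw [Matrix.mul_add, Matrix.add_mul]; abel
    rw [this]; exact add_mem hx hy
  | smul a x _ hx =>
    have : A * (a • x) - (a • x) * A = a • (A * x - x * A) := by
      rw [Matrix.mul_smul, Matrix.smul_mul, smul_sub]
    rw [this]; exact (nPos h h' b).smul_mem _ hx
  | lie x y hx' hy' hx hy =>
    have e : A * ⁅x, y⁆ - ⁅x, y⁆ * A = ⁅A * x - x * A, y⁆ + ⁅x, A * y - y * A⁆ := by
      simp only [Ring.lie_def]; noncomm_ring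
    rw [e]
    exact add_mem ((nPos h h' b).lie_mem hx hy') ((nPos h h' b).lie_mem hx' hy)

omit [CharZero k] in
/-- **`[Lie T̃, 𝔫⁻] ⊆ 𝔫⁻`.** [folklore] -/
theorem lie_mem_nNeg_of_mem_lieAlgebraGL_graphTorus (hT : IsTorusSubgroup T) (hT' : IsTorusSubgroup T')
    {A : Matrix (n ⊕ n') (n ⊕ n') k} (hA : A ∈ lieAlgebraGL (graphTorus eX eX' hT hT'))
    {M : Matrix (n ⊕ n') (n ⊕ n') k} (hM : M ∈ nNeg h h' b) : A * M - M * A ∈ nNeg h h' b := by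
  induction hM using LieSubalgebra.lieSpan_induction with
  | mem x hx =>
    obtain ⟨s, rfl⟩ := hx
    obtain ⟨p, hp⟩ := isAlgebraicChar_graphChar eX eX' hT hT' (-P.root (s : ι))
    rw [lie_eq_tangentDeriv_smul_of_mem_weightSpaceGL hp (graphF_mem_weightSpaceGL h h' hT hT' s) hA]
    exact (nNeg h h' b).smul_mem _ (LieSubalgebra.subset_lieSpan ⟨s, rfl⟩)
  | zero => simp
  | add x y _ _ hx hy =>
    have : A * (x + y) - (x + y) * A = (A * x - x * A) + (A * y - y * A) := by
      rw [Matrix.mul_add, Matrix.add_mul]; abel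
    rw [this]; exact add_mem hx hy
  | smul a x _ hx =>
    have : A * (a • x) - (a • x) * A = a • (A * x - x * A) := by
      rw [Matrix.mul_smul, Matrix.smul_mul, smul_sub]
    rw [this]; exact (nNeg h h' b).smul_mem _ hx
  | lie x y hx' hy' hx hy =>
    have e : A * ⁅x, y⁆ - ⁅x, y⁆ * A = ⁅A * x - x * A, y⁆ + ⁅x, A * y - y * A⁆ := by
      simp only [Ring.lie_def]; noncomm_ring
    rw [e]
    exact add_mem ((nNeg h h' b).lie_mem hx hy') ((nNeg h h' b).lie_mem hx' hy)

include hG hTm hG' hTm' in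
/-- **`[ẽ_s, f̃_t] = δ_{st} h̃_s`, hence lies in `Lie(T̃)`**: for `s ≠ t` simple the bracket is a
weight vector of `Lie(H)` of the non-zero weight `α_s - α_t`, which is not a root
(`RootPairing.Base.sub_notMem_range_root`), hence vanishes. [cite: Humphreys1972, 18.1] -/
theorem lie_graphE_graphF_mem_lieAlgebraGL_graphTorus (s t : ↥b.support) :
    graphE h h' (s : ι) * graphF h h' (t : ι) - graphF h h' (t : ι) * graphE h h' (s : ι) ∈
      lieAlgebraGL (graphTorus eX eX' hTm.2.1 hTm'.2.1) := by
  by_cases hst : s = t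
  · subst hst
    rw [lie_graphE_graphF]
    exact graphHc_mem_lieAlgebraGL_graphTorus h h' hTm.2.1 hTm'.2.1 _
  · have hA : graphE h h' (s : ι) * graphF h h' (t : ι) - graphF h h' (t : ι) * graphE h h' (s : ι) ∈
        lieAlgebraGL (graphGroup h h' hTm.2.1 hTm'.2.1 (b.support : Set ι)) :=
      lie_mem_lieAlgebraGL (graphE_mem_lieAlgebraGL_graphGroup h h' hTm.2.1 hTm'.2.1 s.2)
        (graphF_mem_lieAlgebraGL_graphGroup h h' hTm.2.1 hTm'.2.1 t.2)
    have hw := lie_mem_grW eX eX' hTm.2.1 hTm'.2.1 (graphE_mem_weightSpaceGL h h' hTm.2.1 hTm'.2.1 s)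
      (graphF_mem_weightSpaceGL h h' hTm.2.1 hTm'.2.1 t)
    have hx0 : P.root (s : ι) + -P.root (t : ι) ≠ 0 := by
      rw [← sub_eq_add_neg, sub_ne_zero]; exact root_ne_root_of_ne b hst
    have hx : P.root (s : ι) + -P.root (t : ι) ∉ Set.range P.root := by
      rw [← sub_eq_add_neg]; exact b.sub_notMem_range_root s.2 t.2
    rw [mem_lieAlgebraGL_graphGroup_weight_eq_zero eX eX' h h' hG hTm hG' hTm' hx0 hx hA hw]
    exact Submodule.zero_mem _

include hG hTm hG' hTm' in
/-- **`[ẽ_s, 𝔫⁻] ⊆ Lie(T̃) + 𝔫⁻`** for `s` simple (induction on `𝔫⁻`: on generators this is the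
previous lemma; `ad ẽ_s` is a derivation, and `Lie T̃`, `𝔫⁻` bracket `𝔫⁻` into `𝔫⁻`).
[cite: Humphreys1972, 18.2] -/
theorem lie_graphE_mem_of_mem_nNeg (s : ↥b.support) {M : Matrix (n ⊕ n') (n ⊕ n') k}
    (hM : M ∈ nNeg h h' b) :
    graphE h h' (s : ι) * M - M * graphE h h' (s : ι) ∈
      lieAlgebraGL (graphTorus eX eX' hTm.2.1 hTm'.2.1) ⊔ (nNeg h h' b).toSubmodule := by
  induction hM using LieSubalgebra.lieSpan_induction with
  | mem x hx =>
    obtain ⟨t, rfl⟩ := hx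
    exact Submodule.mem_sup_left (lie_graphE_graphF_mem_lieAlgebraGL_graphTorus h h' b hG hTm hG' hTm' s t)
  | zero => simp
  | add x y _ _ hx hy =>
    have : graphE h h' (s : ι) * (x + y) - (x + y) * graphE h h' (s : ι) =
        (graphE h h' (s : ι) * x - x * graphE h h' (s : ι)) + (graphE h h' (s : ι) * y - y * graphE h h' (s : ι)) := by
      rw [Matrix.mul_add, Matrix.add_mul]; abel
    rw [this]; exact add_mem hx hy
  | smul a x _ hx =>
    have : graphE h h' (s : ι) * (a • x) - (a • x) * graphE h h' (s : ι) =
        a • (graphE h h' (s : ι) * x - x * graphE h h' (s : ι)) := by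
      rw [Matrix.mul_smul, Matrix.smul_mul, smul_sub]
    rw [this]; exact Submodule.smul_mem _ a hx
  | lie x y hx' hy' hx hy =>
    obtain ⟨a₁, ha₁, n₁, hn₁, e₁⟩ := Submodule.mem_sup.1 hx
    obtain ⟨a₂, ha₂, n₂, hn₂, e₂⟩ := Submodule.mem_sup.1 hy
    have hn₁' : n₁ ∈ nNeg h h' b := hn₁
    have hn₂' : n₂ ∈ nNeg h h' b := hn₂
    have e : graphE h h' (s : ι) * ⁅x, y⁆ - ⁅x, y⁆ * graphE h h' (s : ι) =
        ⁅graphE h h' (s : ι) * x - x * graphE h h' (s : ι), y⁆ + ⁅x, graphE h h' (s : ι) * y - y * graphE h h' (s : ι)⁆ := by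
      simp only [Ring.lie_def]; noncomm_ring
    rw [e, ← e₁, ← e₂, add_lie, lie_add]
    refine Submodule.mem_sup_right (add_mem (add_mem ?_ ?_) (add_mem ?_ ?_))
    · change a₁ * y - y * a₁ ∈ nNeg h h' b
      exact lie_mem_nNeg_of_mem_lieAlgebraGL_graphTorus h h' b _ _ ha₁ hy'
    · exact (nNeg h h' b).lie_mem hn₁' hy'
    · change x * a₂ - a₂ * x ∈ nNeg h h' b
      have := lie_mem_nNeg_of_mem_lieAlgebraGL_graphTorus h h' b _ _ ha₂ hx'
      have e3 : x * a₂ - a₂ * x = -(a₂ * x - x * a₂) := by abel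
      rw [e3]; exact (nNeg h h' b).neg_mem this
    · exact (nNeg h h' b).lie_mem hx' hn₂'

include hG hTm hG' hTm' in
/-- **`[f̃_s, 𝔫⁺] ⊆ Lie(T̃) + 𝔫⁺`** for `s` simple. [cite: Humphreys1972, 18.2] -/
theorem lie_graphF_mem_of_mem_nPos (s : ↥b.support) {M : Matrix (n ⊕ n') (n ⊕ n') k}
    (hM : M ∈ nPos h h' b) :
    graphF h h' (s : ι) * M - M * graphF h h' (s : ι) ∈
      lieAlgebraGL (graphTorus eX eX' hTm.2.1 hTm'.2.1) ⊔ (nPos h h' b).toSubmodule := by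
  induction hM using LieSubalgebra.lieSpan_induction with
  | mem x hx =>
    obtain ⟨t, rfl⟩ := hx
    have := lie_graphE_graphF_mem_lieAlgebraGL_graphTorus h h' b hG hTm hG' hTm' t s
    have e : graphF h h' (s : ι) * graphE h h' (t : ι) - graphE h h' (t : ι) * graphF h h' (s : ι) =
        -(graphE h h' (t : ι) * graphF h h' (s : ι) - graphF h h' (s : ι) * graphE h h' (t : ι)) := by abel
    rw [e]
    exact Submodule.mem_sup_left (Submodule.neg_mem _ this)
  | zero => simp
  | add x y _ _ hx hy =>
    have : graphF h h' (s : ι) * (x + y) - (x + y) * graphF h h' (s : ι) =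
        (graphF h h' (s : ι) * x - x * graphF h h' (s : ι)) + (graphF h h' (s : ι) * y - y * graphF h h' (s : ι)) := by
      rw [Matrix.mul_add, Matrix.add_mul]; abel
    rw [this]; exact add_mem hx hy
  | smul a x _ hx =>
    have : graphF h h' (s : ι) * (a • x) - (a • x) * graphF h h' (s : ι) =
        a • (graphF h h' (s : ι) * x - x * graphF h h' (s : ι)) := by
      rw [Matrix.mul_smul, Matrix.smul_mul, smul_sub]
    rw [this]; exact Submodule.smul_mem _ a hx
  | lie x y hx' hy' hx hy =>
    obtain ⟨a₁, ha₁, n₁, hn₁, e₁⟩ := Submodule.mem_sup.1 hx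
    obtain ⟨a₂, ha₂, n₂, hn₂, e₂⟩ := Submodule.mem_sup.1 hy
    have hn₁' : n₁ ∈ nPos h h' b := hn₁
    have hn₂' : n₂ ∈ nPos h h' b := hn₂
    have e : graphF h h' (s : ι) * ⁅x, y⁆ - ⁅x, y⁆ * graphF h h' (s : ι) =
        ⁅graphF h h' (s : ι) * x - x * graphF h h' (s : ι), y⁆ + ⁅x, graphF h h' (s : ι) * y - y * graphF h h' (s : ι)⁆ := by
      simp only [Ring.lie_def]; noncomm_ring
    rw [e, ← e₁, ← e₂, add_lie, lie_add]
    refine Submodule.mem_sup_right (add_mem (add_mem ?_ ?_) (add_mem ?_ ?_))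
    · change a₁ * y - y * a₁ ∈ nPos h h' b
      exact lie_mem_nPos_of_mem_lieAlgebraGL_graphTorus h h' b _ _ ha₁ hy'
    · exact (nPos h h' b).lie_mem hn₁' hy'
    · change x * a₂ - a₂ * x ∈ nPos h h' b
      have := lie_mem_nPos_of_mem_lieAlgebraGL_graphTorus h h' b _ _ ha₂ hx'
      have e3 : x * a₂ - a₂ * x = -(a₂ * x - x * a₂) := by abel
      rw [e3]; exact (nPos h h' b).neg_mem this
    · exact (nPos h h' b).lie_mem hx' hn₂'

include hG hTm hG' hTm' in
/-- **The generators of `𝔡` bracket `V = Lie T̃ + 𝔫⁺ + 𝔫⁻` into itself.** [cite: Humphreys1972, 18.2] -/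
theorem lie_mem_graphTri_of_mem_graphLieGenSet {g : Matrix (n ⊕ n') (n ⊕ n') k}
    (hg : g ∈ graphLieGenSet h h' hTm.2.1 hTm'.2.1 (b.support : Set ι)) {v : Matrix (n ⊕ n') (n ⊕ n') k}
    (hv : v ∈ graphTri h h' b hTm.2.1 hTm'.2.1) : g * v - v * g ∈ graphTri h h' b hTm.2.1 hTm'.2.1 := by
  haveI : IsMulCommutative ↥(graphTorus eX eX' hTm.2.1 hTm'.2.1) := isMulCommutative_graphTorus eX eX' hTm.2.1 hTm'.2.1
  obtain ⟨av, hav, vm, hvm, rfl⟩ := Submodule.mem_sup.1 hv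
  obtain ⟨a, ha, vp, hvp, rfl⟩ := Submodule.mem_sup.1 hav
  have hvp' : vp ∈ nPos h h' b := hvp
  have hvm' : vm ∈ nNeg h h' b := hvm
  have e : g * (a + vp + vm) - (a + vp + vm) * g = (g * a - a * g) + (g * vp - vp * g) + (g * vm - vm * g) := by
    simp only [Matrix.mul_add, Matrix.add_mul]; abel
  rw [e]
  rcases hg with hg | ⟨s, hs, rfl⟩ | ⟨s, hs, rfl⟩
  · -- `g ∈ Lie T̃`
    refine add_mem (add_mem ?_ ?_) ?_
    · exact Submodule.mem_sup_left (Submodule.mem_sup_left (lie_mem_lieAlgebraGL hg ha))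
    · exact Submodule.mem_sup_left (Submodule.mem_sup_right
        (lie_mem_nPos_of_mem_lieAlgebraGL_graphTorus h h' b _ _ hg hvp'))
    · exact Submodule.mem_sup_right (lie_mem_nNeg_of_mem_lieAlgebraGL_graphTorus h h' b _ _ hg hvm')
  · -- `g = ẽ_s`
    refine add_mem (add_mem ?_ ?_) ?_
    · have := lie_mem_nPos_of_mem_lieAlgebraGL_graphTorus h h' b _ _ ha
        (LieSubalgebra.subset_lieSpan ⟨⟨s, hs⟩, rfl⟩ : graphE h h' s ∈ nPos h h' b)
      have e2 : graphE h h' s * a - a * graphE h h' s = -(a * graphE h h' s - graphE h h' s * a) := by abel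
      rw [e2]
      exact Submodule.mem_sup_left (Submodule.mem_sup_right ((nPos h h' b).neg_mem this))
    · exact Submodule.mem_sup_left (Submodule.mem_sup_right
        ((nPos h h' b).lie_mem (LieSubalgebra.subset_lieSpan ⟨⟨s, hs⟩, rfl⟩) hvp'))
    · have := lie_graphE_mem_of_mem_nNeg h h' b hG hTm hG' hTm' ⟨s, hs⟩ hvm'
      obtain ⟨a', ha', m', hm', e'⟩ := Submodule.mem_sup.1 this
      rw [← e']
      exact add_mem (Submodule.mem_sup_left (Submodule.mem_sup_left ha')) (Submodule.mem_sup_right hm')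
  · -- `g = f̃_s`
    refine add_mem (add_mem ?_ ?_) ?_
    · have := lie_mem_nNeg_of_mem_lieAlgebraGL_graphTorus h h' b _ _ ha
        (LieSubalgebra.subset_lieSpan ⟨⟨s, hs⟩, rfl⟩ : graphF h h' s ∈ nNeg h h' b)
      have e2 : graphF h h' s * a - a * graphF h h' s = -(a * graphF h h' s - graphF h h' s * a) := by abel
      rw [e2]
      exact Submodule.mem_sup_right ((nNeg h h' b).neg_mem this)
    · have := lie_graphF_mem_of_mem_nPos h h' b hG hTm hG' hTm' ⟨s, hs⟩ hvp'
      obtain ⟨a', ha', m', hm', e'⟩ := Submodule.mem_sup.1 this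
      rw [← e']
      exact add_mem (Submodule.mem_sup_left (Submodule.mem_sup_left ha'))
        (Submodule.mem_sup_left (Submodule.mem_sup_right hm'))
    · exact Submodule.mem_sup_right ((nNeg h h' b).lie_mem (LieSubalgebra.subset_lieSpan ⟨⟨s, hs⟩, rfl⟩) hvm')

include hG hTm hG' hTm' in
/-- **`[𝔡, V] ⊆ V`** (induction on `𝔡 = ⟨generators⟩`, using `[[z₁, z₂], v] = [z₁, [z₂, v]] - [z₂, [z₁, v]]`).
[cite: Humphreys1972, 18.2] -/
theorem lie_mem_graphTri {z : Matrix (n ⊕ n') (n ⊕ n') k}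
    (hz : z ∈ graphLieGen h h' hTm.2.1 hTm'.2.1 (b.support : Set ι)) {v : Matrix (n ⊕ n') (n ⊕ n') k}
    (hv : v ∈ graphTri h h' b hTm.2.1 hTm'.2.1) : z * v - v * z ∈ graphTri h h' b hTm.2.1 hTm'.2.1 := by
  revert v
  change z ∈ LieSubalgebra.lieSpan k _ _ at hz
  induction hz using LieSubalgebra.lieSpan_induction with
  | mem x hx => intro v hv; exact lie_mem_graphTri_of_mem_graphLieGenSet h h' b hG hTm hG' hTm' hx hv
  | zero => intro v _; simp
  | add x y _ _ hx hy =>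
    intro v hv
    have : (x + y) * v - v * (x + y) = (x * v - v * x) + (y * v - v * y) := by
      rw [Matrix.add_mul, Matrix.mul_add]; abel
    rw [this]; exact add_mem (hx hv) (hy hv)
  | smul a x _ hx =>
    intro v hv
    have : (a • x) * v - v * (a • x) = a • (x * v - v * x) := by
      rw [Matrix.smul_mul, Matrix.mul_smul, smul_sub]
    rw [this]; exact Submodule.smul_mem _ a (hx hv)
  | lie x y _ _ hx hy =>
    intro v hv
    have e : ⁅x, y⁆ * v - v * ⁅x, y⁆ = (x * (y * v - v * y) - (y * v - v * y) * x) -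
        (y * (x * v - v * x) - (x * v - v * x) * y) := by
      simp only [Ring.lie_def]; noncomm_ring
    rw [e]
    exact sub_mem (hx (hy hv)) (hy (hx hv))

include hG hTm hG' hTm' in
/-- **The triangular decomposition `𝔡 = Lie(T̃) + 𝔫⁺ + 𝔫⁻`.** [cite: Humphreys1972, 18.2] -/
theorem graphLieGen_toSubmodule_eq :
    (graphLieGen h h' hTm.2.1 hTm'.2.1 (b.support : Set ι)).toSubmodule = graphTri h h' b hTm.2.1 hTm'.2.1 := by
  apply le_antisymm
  · -- `V` as a Lie subalgebra containing the generators
    let V : LieSubalgebra k (Matrix (n ⊕ n') (n ⊕ n') k) :=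
      { graphTri h h' b hTm.2.1 hTm'.2.1 with
        lie_mem' := fun {x y} hx hy => by
          have hx' : x ∈ graphLieGen h h' hTm.2.1 hTm'.2.1 (b.support : Set ι) := by
            -- `V ⊆ 𝔡`
            have hle : graphTri h h' b hTm.2.1 hTm'.2.1 ≤ (graphLieGen h h' hTm.2.1 hTm'.2.1 (b.support : Set ι)).toSubmodule := by
              refine sup_le (sup_le (lieAlgebraGL_graphTorus_le_graphLieGen h h' _ _ _) ?_) ?_
              · change nPos h h' b ≤ graphLieGen h h' hTm.2.1 hTm'.2.1 (b.support : Set ι)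
                rw [nPos, LieSubalgebra.lieSpan_le]
                rintro _ ⟨s, rfl⟩; exact graphE_mem_graphLieGen h h' _ _ _ s.2
              · change nNeg h h' b ≤ graphLieGen h h' hTm.2.1 hTm'.2.1 (b.support : Set ι)
                rw [nNeg, LieSubalgebra.lieSpan_le]
                rintro _ ⟨s, rfl⟩; exact graphF_mem_graphLieGen h h' _ _ _ s.2
            exact hle hx
          change x * y - y * x ∈ graphTri h h' b hTm.2.1 hTm'.2.1
          exact lie_mem_graphTri h h' b hG hTm hG' hTm' hx' hy }
    change graphLieGen h h' hTm.2.1 hTm'.2.1 (b.support : Set ι) ≤ V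
    rw [graphLieGen, LieSubalgebra.lieSpan_le]
    rintro A (hA | ⟨i, hi, rfl⟩ | ⟨i, hi, rfl⟩)
    · exact Submodule.mem_sup_left (Submodule.mem_sup_left hA)
    · exact Submodule.mem_sup_left (Submodule.mem_sup_right
        (LieSubalgebra.subset_lieSpan ⟨⟨i, hi⟩, rfl⟩ : graphE h h' i ∈ nPos h h' b))
    · exact Submodule.mem_sup_right (LieSubalgebra.subset_lieSpan ⟨⟨i, hi⟩, rfl⟩ : graphF h h' i ∈ nNeg h h' b)
  · refine sup_le (sup_le (lieAlgebraGL_graphTorus_le_graphLieGen h h' _ _ _) ?_) ?_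
    · change nPos h h' b ≤ graphLieGen h h' hTm.2.1 hTm'.2.1 (b.support : Set ι)
      rw [nPos, LieSubalgebra.lieSpan_le]
      rintro _ ⟨s, rfl⟩; exact graphE_mem_graphLieGen h h' _ _ _ s.2
    · change nNeg h h' b ≤ graphLieGen h h' hTm.2.1 hTm'.2.1 (b.support : Set ι)
      rw [nNeg, LieSubalgebra.lieSpan_le]
      rintro _ ⟨s, rfl⟩; exact graphF_mem_graphLieGen h h' _ _ _ s.2

/-! ### Consequences: the weight spaces of `𝔡` at the simple roots and at `0` -/

include hG hTm hG' hTm' in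
/-- **`𝔡 ∩ (𝔤𝔩)_{χ̃_{α_s}} = k ẽ_s` for a simple root `α_s`**: write `M = A + n⁺ + n⁻`,
`n⁺ = ∑_t a_t ẽ_t + (degree ≥ 2)`; every piece except `a_s ẽ_s` lives in weight spaces of weights
`≠ α_s` (`0`, `α_t` with `t ≠ s`, degree `≥ 2`, negatives), so `M = a_s ẽ_s` by independence of the
weight spaces. [cite: Humphreys1972, 18.2 and 14.2] -/
theorem exists_eq_smul_graphE_of_mem_graphLieGen (s : ↥b.support) {M : Matrix (n ⊕ n') (n ⊕ n') k}
    (hM : M ∈ graphLieGen h h' hTm.2.1 hTm'.2.1 (b.support : Set ι))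
    (hw : M ∈ grW eX eX' hTm.2.1 hTm'.2.1 (P.root (s : ι))) : ∃ a : k, M = a • graphE h h' (s : ι) := by
  have hM' : M ∈ graphTri h h' b hTm.2.1 hTm'.2.1 := by
    rw [← graphLieGen_toSubmodule_eq h h' b hG hTm hG' hTm']; exact hM
  obtain ⟨av, hav, vm, hvm, rfl⟩ := Submodule.mem_sup.1 hM'
  obtain ⟨a, ha, vp, hvp, rfl⟩ := Submodule.mem_sup.1 hav
  obtain ⟨e, he, r, hr, rfl⟩ := Submodule.mem_sup.1 (nPos_le_spanE_sup h h' hTm.2.1 hTm'.2.1 hvp)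
  obtain ⟨c, rfl⟩ := (Submodule.mem_span_range_iff_exists_fun k).1 he
  refine ⟨c s, eq_of_sub_mem_biSup_weightSpaceGL eX eX' hTm.2.1 hTm'.2.1 hw
    (Submodule.smul_mem _ _ (graphE_mem_weightSpaceGL h h' hTm.2.1 hTm'.2.1 s)) ?_⟩
  have e : a + ((∑ t, c t • graphE h h' (t : ι)) + r) + vm - c s • graphE h h' (s : ι) =
      a + ((∑ t, c t • graphE h h' (t : ι)) - c s • graphE h h' (s : ι)) + r + vm := by abel
  rw [e]
  refine add_mem (add_mem (add_mem ?_ ?_) ?_) ?_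
  · exact lieAlgebraGL_graphTorus_le_biSup_ne _ _ (P.ne_zero _) ha
  · exact sum_sub_single_mem_biSup_ne_root h h' hTm.2.1 hTm'.2.1 s c
  · exact coneSupPos₂_le_biSup_ne_root _ _ s hr
  · exact coneSupNeg_le_biSup_ne_root _ _ s (nNeg_le_coneSup h h' hTm.2.1 hTm'.2.1 hvm)

include hG hTm hG' hTm' in
/-- **`𝔡 ∩ (𝔤𝔩)_{χ̃_{-α_s}} = k f̃_s` for a simple root `α_s`** (symmetric to the previous statement).
[cite: Humphreys1972, 18.2 and 14.2] -/
theorem exists_eq_smul_graphF_of_mem_graphLieGen (s : ↥b.support) {M : Matrix (n ⊕ n') (n ⊕ n') k}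
    (hM : M ∈ graphLieGen h h' hTm.2.1 hTm'.2.1 (b.support : Set ι))
    (hw : M ∈ grW eX eX' hTm.2.1 hTm'.2.1 (-P.root (s : ι))) : ∃ a : k, M = a • graphF h h' (s : ι) := by
  have hM' : M ∈ graphTri h h' b hTm.2.1 hTm'.2.1 := by
    rw [← graphLieGen_toSubmodule_eq h h' b hG hTm hG' hTm']; exact hM
  obtain ⟨av, hav, vm, hvm, rfl⟩ := Submodule.mem_sup.1 hM'
  obtain ⟨a, ha, vp, hvp, rfl⟩ := Submodule.mem_sup.1 hav
  obtain ⟨e, he, r, hr, rfl⟩ := Submodule.mem_sup.1 (nNeg_le_spanF_sup h h' hTm.2.1 hTm'.2.1 hvm)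
  obtain ⟨c, rfl⟩ := (Submodule.mem_span_range_iff_exists_fun k).1 he
  refine ⟨c s, eq_of_sub_mem_biSup_weightSpaceGL eX eX' hTm.2.1 hTm'.2.1 hw
    (Submodule.smul_mem _ _ (graphF_mem_weightSpaceGL h h' hTm.2.1 hTm'.2.1 s)) ?_⟩
  have e : a + vp + ((∑ t, c t • graphF h h' (t : ι)) + r) - c s • graphF h h' (s : ι) =
      a + vp + ((∑ t, c t • graphF h h' (t : ι)) - c s • graphF h h' (s : ι)) + r := by abel
  rw [e]
  refine add_mem (add_mem (add_mem ?_ ?_) ?_) ?_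
  · exact lieAlgebraGL_graphTorus_le_biSup_ne _ _ (neg_ne_zero.2 (P.ne_zero _)) ha
  · exact coneSupPos_le_biSup_ne_neg_root _ _ s (nPos_le_coneSup h h' hTm.2.1 hTm'.2.1 hvp)
  · exact sum_sub_single_mem_biSup_ne_neg_root h h' hTm.2.1 hTm'.2.1 s c
  · exact coneSupNeg₂_le_biSup_ne_neg_root _ _ s hr

include hG hTm hG' hTm' in
/-- **`𝔡 ∩ (𝔤𝔩)^{T̃} = Lie(T̃)`**: the `𝔫^±`-components of an element of weight `0` vanish (their
weights are non-zero). [cite: Humphreys1972, 18.2] -/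
theorem mem_lieAlgebraGL_graphTorus_of_mem_graphLieGen {M : Matrix (n ⊕ n') (n ⊕ n') k}
    (hM : M ∈ graphLieGen h h' hTm.2.1 hTm'.2.1 (b.support : Set ι))
    (hw : M ∈ grW eX eX' hTm.2.1 hTm'.2.1 0) : M ∈ lieAlgebraGL (graphTorus eX eX' hTm.2.1 hTm'.2.1) := by
  have hM' : M ∈ graphTri h h' b hTm.2.1 hTm'.2.1 := by
    rw [← graphLieGen_toSubmodule_eq h h' b hG hTm hG' hTm']; exact hM
  obtain ⟨av, hav, vm, hvm, rfl⟩ := Submodule.mem_sup.1 hM'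
  obtain ⟨a, ha, vp, hvp, rfl⟩ := Submodule.mem_sup.1 hav
  have key : a + vp + vm = a := by
    refine eq_of_sub_mem_biSup_weightSpaceGL eX eX' hTm.2.1 hTm'.2.1 hw
      (lieAlgebraGL_graphTorus_le_grW_zero eX eX' _ _ ha) ?_
    have e : a + vp + vm - a = vp + vm := by abel
    rw [e]
    exact add_mem (coneSupPos_le_biSup_ne_zero _ _ (nPos_le_coneSup h h' hTm.2.1 hTm'.2.1 hvp))
      (coneSupNeg_le_biSup_ne_zero _ _ (nNeg_le_coneSup h h' hTm.2.1 hTm'.2.1 hvm))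
  rw [key]; exact ha

end Triangular

end Literature.NumberTheory.Automorphic

end
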